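import Summits.BirchSwinnertonDyer.BirchSwinnertonDyer.Theorems.ErratumRoadFiveKatoFframeH2CoinvariantsIndex
import Summits.BirchSwinnertonDyer.BirchSwinnertonDyer.Theorems.ErratumRoadFiveKatoFframeKummerLogNonTorsion
import Summits.BirchSwinnertonDyer.Rank1Residual.Additive.LocalLogImageRat
import Literature.NumberTheory.EllipticCurves.Kato2004.StrictSelmerH2Count
import Literature.NumberTheory.EllipticCurves.BSDQuadraticDescentTorsionOddPartProofs
import Summits.BirchSwinnertonDyer.Rank1Residual.X12.O11.LocalKernelFiniteAtThreeDischarge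
import HarnessLib

/-!
# Route `ErratumRoadFive`, crux `EulerHalfNotRamNoInertSetAtFive` (stmt-BirchSwinnertonDyer-19715), line `kato_Fframe`
# (registered r5.2 `Cruxes/EulerHalfNotRamNoInertSetAtFive/Lines/kato_Fframe_r5.lean` cf457b9468bcf978), stub S1Λ
# `stub_katoLambdaLogBoundTamagawa` — THE ASSEMBLY: S1Λ's registered `∀ (m, Q₀, Q)`-body at `(W, p, z₀, t)` from
# (a) Kato 12.5 (4) in fine form at `z₀` [F1′ shape], (b) a descent package `J ⊇ X₀` with the (14.9.3)+(14.14.2) COUNT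
# [H2Xʳ consumer shape], (c) the A-line index [L3′ shape], (d) the strict Selmer count at a multiplicative `p` [31b-mult shape]

LEAD seat `bsd-line-er5-p1` (g8), `--supports stmt-BirchSwinnertonDyer-19715`; theorems only (no definition, no named fact, no
`sorry`); nothing here closes S1Λ or 19715 — it FIXES THE INTERFACES: the four displayed hypotheses are exactly the conclusions
that the typed fact F1′ (`Kato2004.lengthAt_fineSelmerDual_le_of_isAdmissibleZetaClass`, p763175), the typed fact H2Xʳ
(`Kato2004.exists_iwasawaH2Data_fineSelmerDual_embedding_countRankFree.exists_count_of_finite_coinvariants`, staged), the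
A-line index L3′ (cell bsd-cm `KatoDescentKummerLogLinear` / Part 30 `…KummerUnramifiedCompactSide`) and the strict count
31b at a MULTIPLICATIVE `p` (R-D; with R-C for multiplicative bad `v ∤ p`) deliver, so that the registered stub closes by a
ten-line file once those land (LEAD ruling 2026-08-30 ≈06:2xZ, memo `Lines/kato_Fframe_r5_S1Lambda_level0.md` §1, ref PASS).
HONEST FRAMING: no summit statement is proved; BSD is proved for no curve.

## The arithmetic (all exponents cancel; `vx = ord_p log_ω x̂`, `vt = ord_p t`, `t_v = ord_p #W(ℚ_v)[p^∞]`, `t_p = ord_p #W(ℚ_p)[p^∞]`)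

(iii) (`…H2CoinvariantsIndex`, p763032) with `hnt` (`…KummerLogNonTorsion`, p763590): `(J.H2)_Γ` finite and
`#(J.H2)_Γ ∣ [A₀ : ℤ_p s₀]`; (b): `#(J.H2)_Γ · #W(ℚ)[p^∞] = #Sel_str · #W(ℚ_v)[p^∞]` with `#W(ℚ)[p^∞] = 1` (a hypothesis here; ⟸ `p ∤ #W(ℚ)_tors`);
(c): `ord_p [A₀ : ℤ_p s₀] ≤ vt − vx − a`; (d): `ord_p #Sel_str + t_v + a + 1 = ord_p #Ш + ord_p Tam + vx`. Hence
`ord_p #Ш + ord_p Tam + 2·vx − 1 ≤ vt` (`extremal_bound_of_counts`). The registered `∀ (m, Q₀, Q)`-form follows because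
`m ≤ t_p` (a point of order `p^m`) and `ord_p log_ω Q ≥ 1 + t_p − ord_p c_p` (`log_ω(E(ℚ_p)) = p^{1+t_p−ord_p c_p} ℤ_p` at a
multiplicative `p`, cell b2b-bsdres `LocalLog.range_padicLog_baseChange_of_mult`) — `katoLambdaLogBound_of_counts`.

References: [Kato2004Asterisque] Thm. 12.5 (4) (p. 222), (14.9.3) (p. 240), §14.14 (14.14.1)–(14.14.2) and Lemma 14.15
(pp. 243–244); [GreenbergLNM1716] §3–§4 (control, local kernels); [SilvermanAEC2009] IV.6.4, VII.6.1, VII.6.3 (the image of the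
logarithm, `E(ℚ_p)[p^∞]`); [Mazur1977] III.§5 (p. 157) (`p ∤ #E(ℚ)_tors` under irreducibility).
-/

-- the summit and its single problem are both named `BirchSwinnertonDyer` (registry layout D-0017)
set_option linter.dupNamespace false
set_option autoImplicit false

noncomputable section

open scoped Classical NumberField
open Field IsDedekindDomain WeierstrassCurve
open Literature.NumberTheory.EllipticCurves Literature.NumberTheory.EllipticCurves.Kato2004
open Literature.NumberTheory.EllipticCurves.Kato2004.EulerSystemValues
open Literature.NumberTheory.EllipticCurves.IwasawaAlgebra
open Literature.NumberTheory.GaloisRepresentations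
open Summit.BirchSwinnertonDyer.Rank1Residual Summit.BirchSwinnertonDyer.Rank1Residual.Additive

namespace Summit.BirchSwinnertonDyer.BirchSwinnertonDyer.Theorems.ErratumRoadFiveKatoFframeLambdaAssembly

/-! ## §1 Pure arithmetic -/

/-- The bookkeeping behind S1Λ: from `vS + tv ≤ vind`, `vind ≤ vt − vx − a` and `vS + tv + a + 1 = sha + tam + vx`
follows `sha + tam + 2·vx − 1 ≤ vt`. [folklore] -/
theorem extremal_arith (vS tv vind vt vx a sha tam : ℤ) (h1 : vS + tv ≤ vind) (h2 : vind ≤ vt - vx - a)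
    (h3 : vS + tv + a + 1 = sha + tam + vx) : sha + tam + 2 * vx - 1 ≤ vt := by
  omega

/-- The `∀ (m, Q₀, Q)`-form from the extremal one: if `sha + tam + 2vx − 1 ≤ vt`, `m ≤ tp` and `vQ ≥ 1 + tp − c` then
`sha + vx − vQ + ((tam − c) + m) ≤ vt − vx`. [folklore] -/
theorem graded_arith (sha vx vQ vt tam c m tp : ℤ) (h : sha + tam + 2 * vx - 1 ≤ vt) (hm : m ≤ tp)
    (hQ : 1 + tp - c ≤ vQ) : sha + vx - vQ + ((tam - c) + m) ≤ vt - vx := by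
  omega

/-- `d ∣ n`, `n ≠ 0` ⟹ `v_p d ≤ v_p n`. [folklore] -/
theorem padicValNat_le_of_dvd {p : ℕ} [Fact p.Prime] {d n : ℕ} (h : d ∣ n) (hn : n ≠ 0) :
    padicValNat p d ≤ padicValNat p n :=
  (padicValNat_dvd_iff_le hn).1 (pow_padicValNat_dvd.trans h)

/-! ## §2 Local facts at a multiplicative `p` -/

section Local

variable (W : WeierstrassCurve ℚ) [W.IsElliptic] [W.IsGloballyMinimal] (p : ℕ) [hp : Fact p.Prime]

/-- **A point of order `p^m` in `E(ℚ_p)` forces `m ≤ ord_p #E(ℚ_p)_tors`** (`#E(ℚ_p)[p^∞] = p^{ord_p #E(ℚ_p)_tors}`,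
cell b2b-bsdres `LocalLog.natCard_primaryComponent_point_eq_pow`). [cite: SilvermanAEC2009, VII.6.1 and VII.3.1] -/
theorem le_padicValNat_card_torsion_of_addOrderOf_eq {m : ℕ} {Q₀ : (W.baseChange ℚ_[p]).toAffine.Point}
    (hQ₀ : addOrderOf Q₀ = p ^ m) :
    m ≤ padicValNat p (Nat.card (AddCommGroup.torsion (W.baseChange ℚ_[p]).toAffine.Point)) := by
  have hmem : Q₀ ∈ AddCommGroup.primaryComponent (W.baseChange ℚ_[p]).toAffine.Point p :=
    (AddCommGroup.mem_primaryComponent).mpr ⟨m, by rw [← hQ₀]; exact addOrderOf_nsmul_eq_zero Q₀⟩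
  have hcard := LocalLog.natCard_primaryComponent_point_eq_pow (W.baseChange ℚ_[p]) (p := p)
  have h := addOrderOf_dvd_natCard (⟨Q₀, hmem⟩ : AddCommGroup.primaryComponent (W.baseChange ℚ_[p]).toAffine.Point p)
  rw [← AddSubgroup.addOrderOf_coe] at h
  change addOrderOf Q₀ ∣ _ at h
  rw [hcard, hQ₀] at h
  exact (Nat.pow_dvd_pow_iff_le_right hp.out.one_lt).1 h

/-- **At a MULTIPLICATIVE `p`, every `Q ∈ E(ℚ_p)` with `log_ω Q ≠ 0` has `ord_p log_ω Q ≥ 1 + ord_p #E(ℚ_p)_tors − ord_p c_p`**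
(the image of the logarithm is `p^{1+t−ord_p c_p} ℤ_p`, `LocalLog.range_padicLog_baseChange_of_mult`).
[cite: SilvermanAEC2009, IV.6.4, VII.6.1 and VII.6.3] -/
theorem le_valuation_padicLogLocal_of_mult (hmult : W.HasMultiplicativeReductionAtPrime p)
    {Q : (W.baseChange ℚ_[p]).toAffine.Point} (hQ : padicLogLocal W p Q ≠ 0) :
    (1 : ℤ) + padicValNat p (Nat.card (AddCommGroup.torsion (W.baseChange ℚ_[p]).toAffine.Point)) -
        padicValNat p ((W.baseChange ℚ_[p]).localTamagawaNumber ℤ_[p]) ≤ (padicLogLocal W p Q).valuation := by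
  set e : ℤ := (1 : ℤ) + padicValNat p (Nat.card (AddCommGroup.torsion (W.baseChange ℚ_[p]).toAffine.Point)) -
    padicValNat p ((W.baseChange ℚ_[p]).localTamagawaNumber ℤ_[p]) with he
  have hrange := LocalLog.range_padicLog_baseChange_of_mult W p hmult
  have hmem : padicLogLocal W p Q ∈ (LocalLog.padicLog (W.baseChange ℚ_[p])).range := by
    rw [CongruentShaFreeCutKatoKummerLogTorsion.padicLogLocal_eq_padicLog W p Q]
    exact ⟨Q, rfl⟩
  rw [hrange, Submodule.mem_toAddSubgroup, Submodule.mem_span_singleton] at hmem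
  obtain ⟨a, ha⟩ := hmem
  have hp0 : (p : ℚ_[p]) ≠ 0 := Nat.cast_ne_zero.mpr hp.out.ne_zero
  have ha0 : (a : ℚ_[p]) ≠ 0 := by
    intro h0
    apply hQ
    rw [← ha, Algebra.smul_def, PadicInt.algebraMap_apply, h0, zero_mul]
  have ha_nonneg : (0 : ℤ) ≤ ((a : ℤ_[p]) : ℚ_[p]).valuation := PadicInt.valuation_coe_nonneg
  rw [← ha, Algebra.smul_def, PadicInt.algebraMap_apply, Padic.valuation_mul ha0 (zpow_ne_zero _ hp0),
    Padic.valuation_zpow, Padic.valuation_p, mul_one]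
  linarith

end Local

/-! ## §3 The assembly -/

section Assembly

variable (W : WeierstrassCurve ℚ) [W.IsElliptic] [W.IsGloballyMinimal] (p : ℕ) [hp : Fact p.Prime]
  [ContinuousSMul ℤ_[p] (W.tateModule p)]

/-- **The EXTREMAL bound `ord_p #Ш + ord_p Tam + 2·ord_p log_ω x̂ − 1 ≤ ord_p t` from the four interfaces.** Rank one,
`Ш` finite, `#W(ℚ)[p^∞] = 1` (⟸ `p ∤ #W(ℚ)_tors` ⟸ `ρ̄` irreducible), `(κ, γ)` cyclotomic, `I` a pinned `𝐇¹_Γ(T_pW)`, `z₀ ∈ 𝐇¹_Γ` whose bottom layer has Kummer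
logarithm `t ≠ 0`; (a) `ℓ_𝔭(X₀) ≤ ℓ_𝔭(𝐇¹_Γ/Λz₀)` at every height-one `𝔭` (F1′ at `z₀`); (b) a descent package `J` receiving
`X₀` injectively with finite cokernel, whose finite `(J.H2)_Γ` forces `Sel_str` finite with
`#(J.H2)_Γ·#W(ℚ)[p^∞] = #Sel_str·#W(ℚ_v)[p^∞]` (H2Xʳ's consumer clause); (c) `ord_p [H¹(ℤ[1/p],T_pW) : ℤ_p s₀] ≤ vt − vx − a`;
(d) `ord_p #Sel_str + ord_p #W(ℚ_v)[p^∞] + a + 1 = ord_p #Ш + ord_p Tam + vx`. Then `ord_p #Ш + ord_p Tam + 2vx − 1 ≤ vt`.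
[cite: Kato2004Asterisque, Thm. 12.5 (4) (p. 222), (14.9.3) (p. 240), §14.14 (pp. 243–244)] [cite: GreenbergLNM1716, §4 Lemma 4.2] -/
theorem extremal_bound_of_counts (hrank : W.mordellWeilRank = 1) (hshafin : Finite W.sha)
    (hW1 : Nat.card (AddCommGroup.primaryComponent W.toAffine.Point p) = 1) (xhat : W.toAffine.Point)
    (κ : ZpExtension ℚ p) (hκ : κ.IsCyclotomic) (γ : absoluteGaloisGroup ℚ) (hγ : κ.IsTopGenerator γ)
    (I : IwasawaH1Data W p κ γ) (z₀ : I.H) (t : ℚ_[p])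
    (ht : HasLocPKummerLog W p (layerZeroToTop W p κ (I.proj 0 z₀)) t) (ht0 : t ≠ 0)
    (hlen : ∀ 𝔭 : PrimeSpectrum (IwasawaAlgebra p), 𝔭.asIdeal.height = 1 →
      Module.lengthAt (IwasawaAlgebra p) (W.fineSelmerDualData κ hγ).X 𝔭 ≤
        Module.lengthAt (IwasawaAlgebra p) (I.H ⧸ Submodule.span (IwasawaAlgebra p) {z₀}) 𝔭)
    (J : IwasawaH2Data W p κ γ I) (e : (W.fineSelmerDualData κ hγ).X →ₗ[IwasawaAlgebra p] J.H2)
    (he : Function.Injective e) (hcok : Finite (J.H2 ⧸ LinearMap.range e))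
    (hcount : Finite (coinvariants p J.H2) →
      Finite (katoStrictSelmer W p {primePlace p}) ∧
        Nat.card (coinvariants p J.H2) * Nat.card (AddCommGroup.primaryComponent W.toAffine.Point p) =
          Nat.card (katoStrictSelmer W p {primePlace p}) *
            Nat.card (AddCommGroup.primaryComponent (W.baseChange ((primePlace p).adicCompletion ℚ)).toAffine.Point p))
    (a : ℕ)
    (hindex : (padicValNat p (Nat.card (integralH1 (tateRep W p) p (κ.layerSubgroup 0) ⧸
        Submodule.span ℤ_[p] {(⟨I.proj 0 z₀, I.proj_mem 0 z₀⟩ : integralH1 (tateRep W p) p (κ.layerSubgroup 0))})) : ℤ) ≤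
      t.valuation - (padicLogLocal W p (WeierstrassCurve.Affine.Point.map (Algebra.ofId ℚ ℚ_[p]) xhat)).valuation - a)
    (hstrict : (padicValNat p (Nat.card (katoStrictSelmer W p {primePlace p})) : ℤ) +
        padicValNat p (Nat.card (AddCommGroup.primaryComponent
          (W.baseChange ((primePlace p).adicCompletion ℚ)).toAffine.Point p)) + a + 1 =
      padicValNat p (Nat.card (AddCommGroup.primaryComponent W.sha p)) + padicValNat p W.tamagawaProduct +
        (padicLogLocal W p (WeierstrassCurve.Affine.Point.map (Algebra.ofId ℚ ℚ_[p]) xhat)).valuation) :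
    (padicValNat p W.shaOrder : ℤ) + padicValNat p W.tamagawaProduct +
        2 * (padicLogLocal W p (WeierstrassCurve.Affine.Point.map (Algebra.ofId ℚ ℚ_[p]) xhat)).valuation - 1 ≤
      t.valuation := by
  haveI : Finite (AddCommGroup.primaryComponent W.sha p) := inferInstance
  -- hnt: the bottom layer has infinite order
  have hnt : ¬ IsOfFinAddOrder (I.proj 0 z₀) :=
    ErratumRoadFiveKatoFframeKummerLogNonTorsion.not_isOfFinAddOrder_proj_zero_of_hasLocPKummerLog_ne_zero
      W p κ I z₀ ht ht0
  -- (iii): `(J.H2)_Γ` finite and `#(J.H2)_Γ ∣ [A₀ : ℤ_p s₀]`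
  obtain ⟨hfinJ, hdvd⟩ :=
    ErratumRoadFiveKatoFframeH2CoinvariantsIndex.natCard_coinvariants_H2_dvd_index_of_lengthAt_le_of_rankOne
      W p hrank hκ hγ I J e he hcok z₀ hnt hlen
  -- the index is finite and non-zero
  haveI := ErratumRoadFiveKatoFframeFineDescentRankOne.finite_quotient_span_of_rankOne hrank I z₀ hnt
  have hind0 : Nat.card (integralH1 (tateRep W p) p (κ.layerSubgroup 0) ⧸
      Submodule.span ℤ_[p] {(⟨I.proj 0 z₀, I.proj_mem 0 z₀⟩ :
        integralH1 (tateRep W p) p (κ.layerSubgroup 0))}) ≠ 0 := Nat.card_pos.ne'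
  have h1 : padicValNat p (Nat.card (coinvariants p J.H2)) ≤
      padicValNat p (Nat.card (integralH1 (tateRep W p) p (κ.layerSubgroup 0) ⧸
        Submodule.span ℤ_[p] {(⟨I.proj 0 z₀, I.proj_mem 0 z₀⟩ :
          integralH1 (tateRep W p) p (κ.layerSubgroup 0))})) := padicValNat_le_of_dvd hdvd hind0
  -- (b): the count, with `#W(ℚ)[p^∞] = 1`
  obtain ⟨hfinS, hc⟩ := hcount hfinJ
  rw [hW1, mul_one] at hc
  haveI := hfinS
  have hS0 : Nat.card (katoStrictSelmer W p {primePlace p}) ≠ 0 := Nat.card_pos.ne'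
  haveI := Summit.BirchSwinnertonDyer.Rank1Residual.X12.O11.finite_primaryComponent_point_adicCompletion W p (primePlace p)
  have hT0 : Nat.card (AddCommGroup.primaryComponent
      (W.baseChange ((primePlace p).adicCompletion ℚ)).toAffine.Point p) ≠ 0 := Nat.card_pos.ne'
  have h2 : padicValNat p (Nat.card (coinvariants p J.H2)) =
      padicValNat p (Nat.card (katoStrictSelmer W p {primePlace p})) +
        padicValNat p (Nat.card (AddCommGroup.primaryComponent
          (W.baseChange ((primePlace p).adicCompletion ℚ)).toAffine.Point p)) := by
    rw [hc, padicValNat.mul hS0 hT0]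
  -- `ord_p #Ш[p^∞] = ord_p #Ш`
  have hsha : padicValNat p (Nat.card (AddCommGroup.primaryComponent W.sha p)) = padicValNat p W.shaOrder := by
    rw [natCard_primaryComponent_eq_pow_padicValNat p (A := W.sha), padicValNat.prime_pow]
    rfl
  rw [hsha] at hstrict
  have h1' := congrArg (Nat.cast : ℕ → ℤ) h2
  simp only [Nat.cast_add] at h1'
  exact extremal_arith _ _ _ _ _ _ _ _ (by rw [← h1']; exact_mod_cast h1) hindex hstrict

/-- **S1Λ's registered `∀ (m, Q₀, Q)`-body at `(W, p, z₀, t)`, from the four interfaces.** As `extremal_bound_of_counts`, with `p`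
MULTIPLICATIVE: for every `m`, every local point `Q₀` of order `p^m` and every local point `Q` with `log_ω Q ≠ 0`,
`ord_p #Ш + vx − ord_p log_ω Q + ((ord_p Tam − ord_p c_p) + m) ≤ ord_p t − vx` — the displayed conclusion of
`stub_katoLambdaLogBoundTamagawa` (line `kato_Fframe` r5.2), its `(h1, P, z₀, t)` instantiated by the caller
(`xhat := P (Fin.cast h1.symm 0)`; `logOmega`/`bottomClass` of the skeleton unfold to the terms used here).
[cite: Kato2004Asterisque, Thm. 12.5 (4) (p. 222), (14.9.3) (p. 240), §14.14 (pp. 243–244)] [cite: SilvermanAEC2009, IV.6.4, VII.6.1, VII.6.3] -/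
theorem katoLambdaLogBound_of_counts (hmult : W.HasMultiplicativeReductionAtPrime p)
    (hrank : W.mordellWeilRank = 1) (hshafin : Finite W.sha)
    (hW1 : Nat.card (AddCommGroup.primaryComponent W.toAffine.Point p) = 1) (xhat : W.toAffine.Point)
    (κ : ZpExtension ℚ p) (hκ : κ.IsCyclotomic) (γ : absoluteGaloisGroup ℚ) (hγ : κ.IsTopGenerator γ)
    (I : IwasawaH1Data W p κ γ) (z₀ : I.H) (t : ℚ_[p])
    (ht : HasLocPKummerLog W p (layerZeroToTop W p κ (I.proj 0 z₀)) t) (ht0 : t ≠ 0)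
    (hlen : ∀ 𝔭 : PrimeSpectrum (IwasawaAlgebra p), 𝔭.asIdeal.height = 1 →
      Module.lengthAt (IwasawaAlgebra p) (W.fineSelmerDualData κ hγ).X 𝔭 ≤
        Module.lengthAt (IwasawaAlgebra p) (I.H ⧸ Submodule.span (IwasawaAlgebra p) {z₀}) 𝔭)
    (J : IwasawaH2Data W p κ γ I) (e : (W.fineSelmerDualData κ hγ).X →ₗ[IwasawaAlgebra p] J.H2)
    (he : Function.Injective e) (hcok : Finite (J.H2 ⧸ LinearMap.range e))
    (hcount : Finite (coinvariants p J.H2) →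
      Finite (katoStrictSelmer W p {primePlace p}) ∧
        Nat.card (coinvariants p J.H2) * Nat.card (AddCommGroup.primaryComponent W.toAffine.Point p) =
          Nat.card (katoStrictSelmer W p {primePlace p}) *
            Nat.card (AddCommGroup.primaryComponent (W.baseChange ((primePlace p).adicCompletion ℚ)).toAffine.Point p))
    (a : ℕ)
    (hindex : (padicValNat p (Nat.card (integralH1 (tateRep W p) p (κ.layerSubgroup 0) ⧸
        Submodule.span ℤ_[p] {(⟨I.proj 0 z₀, I.proj_mem 0 z₀⟩ : integralH1 (tateRep W p) p (κ.layerSubgroup 0))})) : ℤ) ≤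
      t.valuation - (padicLogLocal W p (WeierstrassCurve.Affine.Point.map (Algebra.ofId ℚ ℚ_[p]) xhat)).valuation - a)
    (hstrict : (padicValNat p (Nat.card (katoStrictSelmer W p {primePlace p})) : ℤ) +
        padicValNat p (Nat.card (AddCommGroup.primaryComponent
          (W.baseChange ((primePlace p).adicCompletion ℚ)).toAffine.Point p)) + a + 1 =
      padicValNat p (Nat.card (AddCommGroup.primaryComponent W.sha p)) + padicValNat p W.tamagawaProduct +
        (padicLogLocal W p (WeierstrassCurve.Affine.Point.map (Algebra.ofId ℚ ℚ_[p]) xhat)).valuation) :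
    ∀ (m : ℕ) (Q₀ : (W.baseChange ℚ_[p]).toAffine.Point), addOrderOf Q₀ = p ^ m →
    ∀ Q : (W.baseChange ℚ_[p]).toAffine.Point, padicLogLocal W p Q ≠ 0 →
      (padicValNat p W.shaOrder : ℤ) +
            (padicLogLocal W p (WeierstrassCurve.Affine.Point.map (Algebra.ofId ℚ ℚ_[p]) xhat)).valuation
          - (padicLogLocal W p Q).valuation
          + (((padicValNat p W.tamagawaProduct : ℤ)
              - padicValNat p ((W.baseChange ℚ_[p]).localTamagawaNumber ℤ_[p])) + m) ≤
        t.valuation - (padicLogLocal W p (WeierstrassCurve.Affine.Point.map (Algebra.ofId ℚ ℚ_[p]) xhat)).valuation := by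
  intro m Q₀ hQ₀ Q hQ
  have hext := extremal_bound_of_counts W p hrank hshafin hW1 xhat κ hκ γ hγ I z₀ t ht ht0 hlen J e he hcok
    hcount a hindex hstrict
  have hm := le_padicValNat_card_torsion_of_addOrderOf_eq W p hQ₀
  have hvQ := le_valuation_padicLogLocal_of_mult W p hmult hQ
  exact graded_arith _ _ _ _ _ _ _ _ hext (by exact_mod_cast hm) hvQ

end Assembly

end Summit.BirchSwinnertonDyer.BirchSwinnertonDyer.Theorems.ErratumRoadFiveKatoFframeLambdaAssembly

end
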